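import Literature.NumberTheory.Automorphic.UnboundedDenominatorsFinitenessProofs
import HarnessLib

/-!
# The unbounded denominators theorem (Calegari–Dimitrov–Tang) — Lemma 4.2.2/4.2.3: `[R_N : M_2]` from a bound on independent generators

PROOF-ONLY sequel (no definition, no named fact; D-0026) of the fields instalment (`…Fields`,
`…FieldsProofs`, `…LambdaFieldProofs`: `M_2 = levelField 2 = ℂ⟮λ⟯`, `R_N = bddDenField N`, generators
`bddDenGens N` forming a monoid). Source: F. Calegari, V. Dimitrov, Y. Tang, *The unbounded
denominators conjecture*, J. Amer. Math. Soc. **38** (2025), 627–702 = arXiv:2109.09040, Lemma 4.2.2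
("`M_N` and `R_N` have finite dimensions over `M_2 = ℚ(λ)` … follows from Corollary 2.0.3
[the holonomy bound]") and Lemma 4.2.3 ("any integral domain which has finite dimension over a field
is itself a field").

The holonomy bound (Theorem 2.0.1 / Proposition 3.0.1, tree `…DimensionBoundProofs.lean`) bounds
the number of LINEARLY INDEPENDENT admissible functions; the leveraging argument
(`…of_printed_inputs'`) wants the DEGREE `[R_N : M_2]` as `IntermediateField.relfinrank`. This file is
the bridge:

* ★ `relfinrank_pos_and_le_of_linearIndepOn_bound` — if every finite set of generators of `R_N`
  (`N` even) that is linearly independent over `M_2` has at most `B` elements, then `R_N` is the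
  `M_2`-SPAN of its generators (a finite-dimensional domain over the field `M_2`, hence a field),
  `0 < [R_N : M_2]` and `[R_N : M_2] ≤ B`; real-valued form
  `relfinrank_pos_and_le_of_linearIndepOn_real_bound`;
* ★★ `CalegariDimitrovTang2025_unboundedDenominators.of_printed_inputs''` — Theorem 1.0.1 from
  `hker₂`, `hcor`, Shimura 3.52, (4.3.3), and Proposition 3.0.1 **as a bound `C N³ log N` on the size of
  `M_2`-independent families of generators of `R_N`** (the shape the holonomy bound delivers).

## References

* [CalegariDimitrovTang2025] F. Calegari, V. Dimitrov, Y. Tang, The unbounded denominators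
  conjecture, J. Amer. Math. Soc. 38 (2025), no. 3, 627–702; arXiv:2109.09040. Lemmas 4.2.2, 4.2.3.
-/

noncomputable section

namespace Literature.NumberTheory.Automorphic

open scoped MatrixGroups ModularForm Manifold
open UpperHalfPlane CongruenceSubgroup Matrix.SpecialLinearGroup ModularGroup

namespace UnboundedDenominators

/-- A set all of whose finite subsets have at most `B` elements is finite with at most `B`
elements. [folklore] -/
private theorem finite_of_forall_finset_card_le {α : Type*} {b : Set α} {B : ℕ}
    (h : ∀ s : Finset α, (s : Set α) ⊆ b → s.card ≤ B) :
    ∃ hb : b.Finite, hb.toFinset.card ≤ B := by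
  by_cases hfin : b.Finite
  · exact ⟨hfin, h _ (by simp)⟩
  · obtain ⟨t, ht, hcard⟩ := Set.Infinite.exists_subset_card_eq hfin (B + 1)
    have := h t ht
    omega

set_option maxHeartbeats 400000 in
/-- ★ **`[R_N : M_2]` from a bound on independent generators** [cite: CalegariDimitrovTang2025,
Lemmas 4.2.2 and 4.2.3]. Let `N` be even and suppose every finite set of generators of `R_N`
(`bddDenGens N`) which is linearly independent over `M_2 = levelField 2` has at most `B` elements
(this is what the holonomy bound of Theorem 2.0.1 / Proposition 3.0.1 delivers). Then
`0 < [R_N : M_2] ≤ B` as `IntermediateField.relfinrank` — the field `R_N` is the `M_2`-span of its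
generators ("any integral domain which has finite dimension over a field is itself a field"). -/
theorem relfinrank_pos_and_le_of_linearIndepOn_bound {N B : ℕ} (hN : 0 < N) (heven : Even N)
    (hB : ∀ s : Finset Mer, (s : Set Mer) ⊆ bddDenGens N →
      LinearIndepOn (levelField 2) id (s : Set Mer) → s.card ≤ B) :
    0 < IntermediateField.relfinrank (levelField 2) (bddDenField N) ∧
      IntermediateField.relfinrank (levelField 2) (bddDenField N) ≤ B := by
  classical
  have hN0 : N ≠ 0 := hN.ne'
  -- notation
  set K : IntermediateField ℂ Mer := levelField 2 with hKdef
  have hKE : K ≤ bddDenField N :=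
    (levelField_mono two_pos heven.two_dvd hN0).trans (levelField_le_bddDenField N)
  -- a maximal independent set of generators: finite, of size `≤ B`, spanning the span
  obtain ⟨b, hbsub, hspan, hli⟩ := exists_linearIndependent K (bddDenGens N)
  have hbli : LinearIndepOn K id b := hli
  obtain ⟨hbfin, hbcard⟩ : ∃ hb : b.Finite, hb.toFinset.card ≤ B :=
    finite_of_forall_finset_card_le fun s hs ↦ hB s (hs.trans hbsub) (hbli.mono hs)
  haveI : Fintype b := hbfin.fintype
  -- the `K`-algebra generated by the generators is their `K`-span (they form a monoid)
  let A : Subalgebra K Mer := Algebra.adjoin K (bddDenGens N)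
  have hA : Subalgebra.toSubmodule A = Submodule.span K (bddDenGens N) := by
    rw [Algebra.adjoin_eq_span, coe_submonoidClosure_bddDenGens hN0]
  have hAfg : (Subalgebra.toSubmodule A).FG := by
    rw [hA, ← hspan]
    exact Submodule.fg_span hbfin
  -- it is closed under inverses (finite-dimensional ⟹ algebraic), hence an intermediate field
  have hinv : ∀ x ∈ A, x⁻¹ ∈ A := fun x hx ↦
    A.inv_mem_of_algebraic (x := ⟨x, hx⟩) (IsIntegral.of_mem_of_fg A hAfg x hx).isAlgebraic
  let F' : IntermediateField K Mer := A.toIntermediateField hinv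
  -- and it is `R_N` (viewed over `K = M_2`)
  have hEq : IntermediateField.extendScalars hKE = F' := by
    apply le_antisymm
    · -- `R_N = ℂ(gens) ⊆ F'` since `F'` is a field containing `ℂ` and the generators
      intro x hx
      have hx' : x ∈ bddDenField N := hx
      have hle : bddDenField N ≤ IntermediateField.restrictScalars ℂ F' :=
        IntermediateField.adjoin_le_iff.mpr fun y hy ↦ Algebra.subset_adjoin hy
      exact hle hx'
    · -- `F' = K[gens] ⊆ R_N`
      intro x hx
      have hx' : x ∈ A := hx
      change x ∈ bddDenField N
      have hle : A ≤ (IntermediateField.extendScalars hKE).toSubalgebra :=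
        Algebra.adjoin_le fun y hy ↦ IntermediateField.subset_adjoin ℂ _ hy
      exact hle hx'
  -- the degree is the dimension of the span, `= #b`
  have hfinrank : IntermediateField.relfinrank K (bddDenField N) = hbfin.toFinset.card := by
    rw [IntermediateField.relfinrank_eq_finrank_of_le hKE, hEq,
      ← IntermediateField.finrank_eq_finrank_subalgebra, toSubalgebra_toIntermediateField,
      ← Subalgebra.finrank_toSubmodule, hA, ← hspan, finrank_span_set_eq_card hbli,
      Set.Finite.toFinset_eq_toFinset]
  -- `b` is nonempty: `1` lies in the span of the generators
  have hbne : b.Nonempty := by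
    by_contra hb
    rw [Set.not_nonempty_iff_eq_empty] at hb
    have h1 : (1 : Mer) ∈ Submodule.span K (bddDenGens N) :=
      Submodule.subset_span (one_mem_bddDenGens N)
    rw [← hspan, hb, Submodule.span_empty, Submodule.mem_bot] at h1
    exact one_ne_zero h1
  rw [hfinrank]
  exact ⟨Finset.card_pos.mpr ((Set.Finite.toFinset_nonempty hbfin).mpr hbne), hbcard⟩


/-- From a real bound on independent generators to the two degree inputs of the assembly:
`0 < [R_N : M_2]` and `[R_N : M_2] ≤ C N³ log N`. [cite: CalegariDimitrovTang2025, Lemma 4.2.2 and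
Proposition 3.0.1] -/
theorem relfinrank_pos_and_le_of_linearIndepOn_real_bound {N : ℕ} {C : ℝ} (hN : 0 < N)
    (heven : Even N)
    (hB : ∀ s : Finset Mer, (s : Set Mer) ⊆ bddDenGens N →
      LinearIndepOn (levelField 2) id (s : Set Mer) → (s.card : ℝ) ≤ C * (N : ℝ) ^ 3 * Real.log N) :
    0 < IntermediateField.relfinrank (levelField 2) (bddDenField N) ∧
      (IntermediateField.relfinrank (levelField 2) (bddDenField N) : ℝ) ≤
        C * (N : ℝ) ^ 3 * Real.log N := by
  have hB' : ∀ s : Finset Mer, (s : Set Mer) ⊆ bddDenGens N →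
      LinearIndepOn (levelField 2) id (s : Set Mer) → s.card ≤ ⌊C * (N : ℝ) ^ 3 * Real.log N⌋₊ :=
    fun s hs hli ↦ Nat.le_floor (hB s hs hli)
  obtain ⟨hpos, hle⟩ := relfinrank_pos_and_le_of_linearIndepOn_bound hN heven hB'
  refine ⟨hpos, ?_⟩
  have h0 : (0 : ℝ) ≤ C * (N : ℝ) ^ 3 * Real.log N := by
    -- the empty family is independent, so `0 ≤ C N³ log N`
    have := hB ∅ (by simp) (by simp)
    simpa using this
  calc (IntermediateField.relfinrank (levelField 2) (bddDenField N) : ℝ)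
      ≤ (⌊C * (N : ℝ) ^ 3 * Real.log N⌋₊ : ℝ) := by exact_mod_cast hle
    _ ≤ C * (N : ℝ) ^ 3 * Real.log N := Nat.floor_le h0

/-- ★★ **CDT Theorem 1.0.1 from its printed inputs, with Proposition 3.0.1 in the shape the holonomy
bound delivers** [cite: CalegariDimitrovTang2025, §6.3, Proposition 3.0.1, Lemma 4.2.2]: the named
fact `CalegariDimitrovTang2025_unboundedDenominators` follows from `hker₂` (amalgam + CSP), `hcor`
(Corollary 4.5.3), Shimura's Theorem 3.52, the degree formula (4.3.3) `[M_N : M_2] ≥ c N³`, and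
**Proposition 3.0.1 as a bound on independent families: every finite set of generators of `R_N`
(`N` even) linearly independent over `M_2` has at most `C N³ log N` elements.** -/
theorem _root_.Literature.NumberTheory.Automorphic.CalegariDimitrovTang2025_unboundedDenominators.of_printed_inputs''
    (hker₂ : ∀ (N p : ℕ) (A : GL (Fin 2) ℝ), 0 < N →
      (A : Matrix (Fin 2) (Fin 2) ℝ) = !![(p : ℝ), 0; 0, 1] → p.Prime → ¬ p ∣ N →
      ∀ (Δ : Type) [Group Δ] [Finite Δ] (g₁ g₂ : Gamma N →* Δ),
      (∀ (x : SL(2, ℤ)) (hx : x ∈ Gamma N), x ∈ Gamma0 p → ∀ (y : SL(2, ℤ)) (hy : y ∈ Gamma N),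
        A * mapGL ℝ x = mapGL ℝ y * A → g₁ ⟨x, hx⟩ = g₂ ⟨y, hy⟩) →
      (∃ M : ℕ, M ≠ 0 ∧ ∀ (x : SL(2, ℤ)) (hx : x ∈ Gamma N), x ∈ Gamma M → g₁ ⟨x, hx⟩ = 1) ∧
      (∃ M : ℕ, M ≠ 0 ∧ ∀ (x : SL(2, ℤ)) (hx : x ∈ Gamma N), x ∈ Gamma M → g₂ ⟨x, hx⟩ = 1))
    (hcor : ∀ (N : ℕ) (Q : Type) [CommGroup Q] [Finite Q] (θ : Gamma N →* Q),
      (∀ g : SL(2, ℤ), ∃ M : ℕ, M ≠ 0 ∧ ∀ (x : SL(2, ℤ)) (hx : x ∈ Gamma N)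
        (hgx : g * x * g⁻¹ ∈ Gamma N), x ∈ Gamma M → θ ⟨g * x * g⁻¹, hgx⟩ = θ ⟨x, hx⟩) →
      ∃ M : ℕ, M ≠ 0 ∧ ∀ (x : SL(2, ℤ)) (hx : x ∈ Gamma N), x ∈ Gamma M → θ ⟨x, hx⟩ = 1)
    (hShimura : ∀ (N : ℕ), 0 < N → ∀ (m : ℕ)
      (F : ModularForm ((Gamma N : Subgroup SL(2, ℤ)) : Subgroup (GL (Fin 2) ℝ)) (12 * (m : ℤ))),
      ∃ (ι : Type) (_ : Fintype ι) (c : ι → ℂ)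
      (B : ι → ModularForm ((Gamma N : Subgroup SL(2, ℤ)) : Subgroup (GL (Fin 2) ℝ)) (12 * (m : ℤ))),
      (∀ i (n : ℕ), ∃ z : ℤ, PowerSeries.coeff n (qExpansion (N : ℝ) (B i)) = (z : ℂ)) ∧
      (F : ℍ → ℂ) = ∑ i, c i • (B i : ℍ → ℂ))
    (hdeg : ∃ c : ℝ, 0 < c ∧ ∀ N : ℕ, 0 < N → Even N →
      c * (N : ℝ) ^ 3 ≤ IntermediateField.relfinrank (levelField 2) (levelField N))
    (hhol : ∃ C : ℝ, ∀ N : ℕ, 0 < N → Even N → ∀ s : Finset Mer, (s : Set Mer) ⊆ bddDenGens N →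
      LinearIndepOn (levelField 2) id (s : Set Mer) → (s.card : ℝ) ≤ C * (N : ℝ) ^ 3 * Real.log N) :
    CalegariDimitrovTang2025_unboundedDenominators := by
  obtain ⟨C, hC⟩ := hhol
  exact CalegariDimitrovTang2025_unboundedDenominators.of_printed_inputs' hker₂ hcor hShimura
    (fun N hN heven ↦ (relfinrank_pos_and_le_of_linearIndepOn_real_bound hN heven (hC N hN heven)).1)
    hdeg ⟨C, fun N hN heven ↦
      (relfinrank_pos_and_le_of_linearIndepOn_real_bound hN heven (hC N hN heven)).2⟩

end UnboundedDenominators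


end Literature.NumberTheory.Automorphic

end
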